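import Literature.Computability.QuantumComplexity.RevTableau
import HarnessLib

/-!
# Garbage-free reversible computation of `FP` functions: compute, copy, uncompute

Trunk `CryptoQuantFine`, toolkit continuing `RevTableau.lean` (the explicit layered reversible
tableau `RevSim.inputOps`/`RevSim.stepOps` of a polynomial-time `FinTM2` machine, wires indexed
by `ℕ`, every gate a `NOT`/`CNOT`/Toffoli writing into a fresh wire, `RevSim.inv_wAt`). The
tableau leaves its whole history as garbage. For *interfering* uses of a classical subroutine —
the modular-exponentiation block of Shor's order finding (Shor 1997, §3), classical pre/post-
processing inside a quantum computation — the garbage must be erased, by Bennett's trick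
(Bennett 1973; Shor 1997, §3, p. 8: "once the output `F(x)` has been computed, copy it into a
register that has been preset to zero, and then undo the computation to erase both the first
OUTPUT register and the RECORD register"; Kitaev 1995, §2.2, Lemma 1: the garbage-free form
`(u, 0, 0) ↦ (u, F(u), 0)` in `2L + m` operations). This file builds that block over the
tableau and proves its classical semantics:

* program algebra (`RevGadgets.ClOp`): `clEval_reverse_clEval` (a well-formed program run
  backwards undoes itself, `ClOp.eval_involutive`), `clEval_ite` (a program commutes with
  changes to wires it does not mention), `clEval_copyOps_target`/`_of_ne` (a fan-out layer of
  `CNOT`s onto fresh wires);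
* the block `RevClean.cleanOps e M n₀ v`: on `n₀` data wires `u` followed by work wires it
  (i) writes the constant word `v` behind the data by `NOT` gates (`notsV`; a fixed,
  input-length dependent suffix that a machine can use as a delimiter/format — it plays the
  role of the hard-wired constants of a circuit), (ii) runs the tableau `comp e M n` of `M` on
  the `n = n₀ + |v|` wires `u v` for `T(n) = (n+2)^e` steps, (iii) copies the one-hot code of
  every cell of the output stack of the last layer onto fresh *result wires* (`outOps`), (iv)
  runs the tableau backwards and (v) clears `v`;
* **semantics** `RevClean.clEval_cleanOps`: if `M` halts on `u ++ v` with output `l'` within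
  `T(n)` steps, the block maps the assignment `u 0 0 …` to `u 0^{…} ρ(l') 0 …`: data unchanged,
  all work wires zero again except the result wires, which hold `readOut l'`, an injective
  (`RevClean.eq_of_readOut_eq`) code of the output word — i.e. `|u⟩|0⟩ ↦ |u⟩|code (M(u v))⟩`
  with no garbage;
* well-formedness and wire bounds (`cleanOps_wf`, `cleanOps_lt`) for the compilation to
  Clifford+T by `revCompile` (`ReversibleCliffordT.lean`), and the time-bound bridge
  `exists_outputsWithin_pow_of_mem_FP` (`f ∈ FP` gives a machine halting within `(n+2)^e`).

Uniformity of the block (its description printed in polynomial time, including the reversed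
half) is the subject of `RevUncomputeUniform.lean`.

## References

* C. H. Bennett, *Logical reversibility of computation*, IBM J. Res. Develop. 17 (1973)
  525–532, §2 (compute – copy output – uncompute). (Not held; the three-stage construction is
  restated in the two held sources below and fully proved here.)
* P. W. Shor, *Polynomial-time algorithms for prime factorization and discrete logarithms on a
  quantum computer*, SIAM J. Comput. 26 (1997) 1484–1509, §3 (reversible logic, p. 8 of
  arXiv:quant-ph/9508027v2).
* A. Yu. Kitaev, *Quantum measurements and the Abelian Stabilizer Problem*,
  arXiv:quant-ph/9511026 (1995), §2.2, Lemma 1.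
* M. A. Nielsen, I. L. Chuang, *Quantum Computation and Quantum Information*, CUP 2010,
  §3.2.5 (uncomputation, eq. (3.7)).
-/

namespace Literature.Computability.QuantumComplexity

open Complexity Complexity.FinTM2Sim Turing Function RevSim

/-! ### Program algebra: running backwards, frames, fan-out -/

section Algebra

variable {ι : Type*} [DecidableEq ι]

/-- **A well-formed reversible program run backwards undoes itself** (every operation is an
involution, `ClOp.eval_involutive`). [Bennett 1973, §2; Nielsen–Chuang 2010, §3.2.5]
[cite: NielsenChuang2010, §3.2.5] -/
theorem clEval_reverse_clEval : ∀ (ops : List (ClOp ι)) (_ : ∀ op ∈ ops, op.WF) (w : ι → Bool),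
    clEval ops.reverse (clEval ops w) = w
  | [], _, w => rfl
  | op :: ops, h, w => by
    have ih := clEval_reverse_clEval ops (fun o ho => h o (List.mem_cons_of_mem _ ho)) (op.eval w)
    simp only [List.reverse_cons, clEval_append, clEval_cons, clEval_nil] at ih ⊢
    rw [ih]
    exact ClOp.eval_involutive (h op (by simp)) w

omit [DecidableEq ι] in
/-- The reverse of a program of well-formed operations is well formed. [folklore] -/
theorem wf_reverse {ops : List (ClOp ι)} (h : ∀ op ∈ ops, op.WF) : ∀ op ∈ ops.reverse, op.WF :=
  fun op hop => h op (List.mem_reverse.1 hop)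

/-- **Frame rule.** A program commutes with overwriting wires that it neither reads nor writes.
[folklore] -/
theorem clEval_ite (p : ι → Prop) [DecidablePred p] :
    ∀ (ops : List (ClOp ι)) (_ : ∀ op ∈ ops, ¬ p op.target ∧ ∀ c ∈ op.controls, ¬ p c)
      (g w : ι → Bool),
      clEval ops (fun i => if p i then g i else w i) = fun i => if p i then g i else clEval ops w i
  | [], _, g, w => rfl
  | op :: ops, h, g, w => by
    have hop := h op (by simp)
    have key : op.eval (fun i => if p i then g i else w i) =
        fun i => if p i then g i else op.eval w i := by
      have hg : op.guard (fun i => if p i then g i else w i) = op.guard w :=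
        ClOp.guard_congr op fun c hc => by rw [if_neg (hop.2 c hc)]
      funext i
      rw [ClOp.eval_apply, ClOp.eval_apply, hg]
      by_cases hi : p i
      · have : op.target ≠ i := fun e => hop.1 (e ▸ hi)
        simp [hi, this]
      · simp [hi]
    rw [clEval_cons, clEval_cons, key,
      clEval_ite p ops (fun o ho => h o (List.mem_cons_of_mem _ ho)) g (op.eval w)]

/-- **Agreement.** Two assignments that agree on every wire mentioned by a program still agree
on these wires after the program. [folklore] -/
theorem clEval_agree (P : ι → Prop) :
    ∀ (ops : List (ClOp ι)) (_ : ∀ op ∈ ops, ∀ i ∈ wiresOf op, P i) {w w' : ι → Bool}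
      (_ : ∀ i, P i → w i = w' i) (i : ι), P i → clEval ops w i = clEval ops w' i
  | [], _, _, _, hw, i, hi => hw i hi
  | op :: ops, hops, w, w', hw, i, hi => by
    rw [clEval_cons, clEval_cons]
    refine clEval_agree P ops (fun o ho => hops o (List.mem_cons_of_mem _ ho)) (fun i' hi' => ?_) i hi
    have hop := hops op (by simp)
    rw [ClOp.eval_apply, ClOp.eval_apply, hw i' hi',
      ClOp.guard_congr op (fun c hc => hw c (hop c (by simp [hc])))]

/-- A fan-out layer: `CNOT`s from the sources to the targets of a list of pairs. [folklore] -/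
def copyOps (ps : List (ι × ι)) : List (ClOp ι) := ps.map fun p => ClOp.cnot p.1 p.2

omit [DecidableEq ι] in
/-- Members of a fan-out layer. [folklore] -/
theorem mem_copyOps {ps : List (ι × ι)} {op : ClOp ι} :
    op ∈ copyOps ps ↔ ∃ p ∈ ps, op = ClOp.cnot p.1 p.2 := by
  simp [copyOps, eq_comm]

/-- **Fan-out onto fresh wires**: if the targets are pairwise distinct and none of them is a
source, each target receives (the XOR with) its source. [Nielsen–Chuang 2010, §3.2.5 (FANOUT
by CNOT)] [cite: NielsenChuang2010, §3.2.5] -/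
theorem clEval_copyOps_target (ps : List (ι × ι)) (hnd : (ps.map Prod.snd).Nodup)
    (hdis : ∀ p ∈ ps, ∀ q ∈ ps, q.2 ≠ p.1) (w : ι → Bool) {p : ι × ι} (hp : p ∈ ps) :
    clEval (copyOps ps) w p.2 = (w p.2 ^^ w p.1) := by
  have h1 : ∀ op ∈ copyOps ps, ∀ op' ∈ copyOps ps, op'.target ∉ op.controls := by
    intro op hop op' hop'
    obtain ⟨a, ha, rfl⟩ := mem_copyOps.1 hop
    obtain ⟨b, hb, rfl⟩ := mem_copyOps.1 hop'
    simpa [ClOp.target, ClOp.controls] using hdis a ha b hb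
  have h2 : ((copyOps ps).map ClOp.target).Nodup := by
    rw [copyOps, List.map_map]
    exact hnd
  have := clEval_apply_target_of_nodup (copyOps ps) h1 h2 w (op := ClOp.cnot p.1 p.2)
    (mem_copyOps.2 ⟨p, hp, rfl⟩)
  simpa [ClOp.target, ClOp.guard] using this

/-- A fan-out layer leaves the other wires unchanged. [folklore] -/
theorem clEval_copyOps_of_ne (ps : List (ι × ι)) (w : ι → Bool) {i : ι} (hi : ∀ p ∈ ps, p.2 ≠ i) :
    clEval (copyOps ps) w i = w i :=
  clEval_apply_of_forall_target_ne _ _ fun op hop => by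
    obtain ⟨p, hp, rfl⟩ := mem_copyOps.1 hop
    exact hi p hp

omit [DecidableEq ι] in
/-- The operations of a fan-out layer with no fixed pair are well formed. [folklore] -/
theorem copyOps_wf {ps : List (ι × ι)} (h : ∀ p ∈ ps, p.1 ≠ p.2) : ∀ op ∈ copyOps ps, op.WF := by
  intro op hop
  obtain ⟨p, hp, rfl⟩ := mem_copyOps.1 hop
  exact h p hp

end Algebra

/-! ### The clean block: layout and gadgets -/

namespace RevClean

open RevSim

attribute [local instance] Turing.FinTM2.kFin Turing.FinTM2.ΛFin Turing.FinTM2.σFin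
  Turing.FinTM2.Γk₀Fin

section Defs

variable (e : ℕ) (M : TM2ComputableAux Bool Bool)

/-- The compute half: input layer and `T(n)` simulation steps of the tableau (`RevSim.allOps`
without its read-out). [cite: AroraBarak2009, §10.3.7 Lemma 10.10] -/
noncomputable def comp (n : ℕ) : List (ClOp ℕ) :=
  inputOps e M n ++ (List.range (Tn e n)).flatMap (stepOps M.tm e n)

/-- The positions of the `1`s of the constant suffix `v`, as `NOT` gates behind the `n₀` data
wires. [folklore] -/
def notsV (n₀ : ℕ) (v : List Bool) : List (ClOp ℕ) :=
  ((List.range v.length).filter fun i => v.getD i false).map fun i => ClOp.not (n₀ + i)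

/-- The cell codes of the output stack (`none` = empty cell). [folklore] -/
abbrev OSym : Type := Option (StackSym M.tm M.tm.k₁)

/-- The number of cell codes of the output stack. [folklore] -/
noncomputable def A₁ : ℕ := Nat.card (OSym M)

/-- A numbering of the cell codes of the output stack. [folklore] -/
noncomputable def eA : OSym M ≃ Fin (A₁ M) := Finite.equivFin _

/-- The cell codes of the output stack, listed. [folklore] -/
noncomputable def aList : List (OSym M) := (List.finRange (A₁ M)).map (eA M).symm

/-- The number of cells of the last layer that are read out (all of them). [folklore] -/
noncomputable def JJ (n : ℕ) : ℕ := Sn M.tm e n + dd M.tm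

/-- The result wire of cell `j` and code `a`: after all tableau wires. [folklore] -/
noncomputable def resW (n j : ℕ) (a : OSym M) : ℕ := NN e M n + (j * A₁ M + eA M a)

/-- The number of result wires. [folklore] -/
noncomputable def copyN (n : ℕ) : ℕ := JJ e M n * A₁ M

/-- The total number of wires of the block on tableau input length `n`. [folklore] -/
noncomputable def width (n : ℕ) : ℕ := NN e M n + copyN e M n

/-- Source/target pairs of the read-out: the one-hot wire of (cell `j` of the output stack of
the last layer holds code `a`) is copied onto `resW n j a`. [folklore] -/
noncomputable def outPairs (n : ℕ) : List (ℕ × ℕ) :=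
  (List.range (JJ e M n)).flatMap fun j => (aList M).map fun a =>
    (cellW M.tm e n (Tn e n) j ⟨M.tm.k₁, a⟩, resW e M n j a)

/-- The read-out layer. [Bennett 1973, §2 (copy the output)] [cite: Shor1997, §3 p.8] -/
noncomputable def outOps (n : ℕ) : List (ClOp ℕ) := copyOps (outPairs e M n)

/-- **The clean block** on `n₀` data wires with constant suffix `v` (tableau input length
`n = n₀ + |v|`): write `v`, compute, copy the output cells, uncompute, clear `v`.
[Bennett 1973, §2; Shor 1997, §3; Kitaev 1995, §2.2 Lemma 1] [cite: Shor1997, §3 p.8] -/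
noncomputable def cleanOps (n₀ : ℕ) (v : List Bool) : List (ClOp ℕ) :=
  notsV n₀ v ++ (comp e M (n₀ + v.length) ++ (outOps e M (n₀ + v.length) ++
    ((comp e M (n₀ + v.length)).reverse ++ notsV n₀ v)))

end Defs

/-! ### Elementary facts on the layout -/

section Layout

variable {e : ℕ} {M : TM2ComputableAux Bool Bool}

/-- Every code is listed. [folklore] -/
theorem mem_aList (a : OSym M) : a ∈ aList M := by
  simp only [aList, List.mem_map, List.mem_finRange, true_and]
  exact ⟨eA M a, by simp⟩

/-- The list of codes has no duplicates. [folklore] -/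
theorem nodup_aList : (aList M).Nodup :=
  (List.nodup_finRange _).map (eA M).symm.injective

/-- There is a code (`none`). [folklore] -/
theorem one_le_A₁ : 1 ≤ A₁ M := by
  have : 0 < A₁ M := by
    rw [A₁]; exact Nat.card_pos (α := OSym M)
  exact this

/-- Result wires are injective in `(j, a)`. [folklore] -/
theorem resW_inj {n j j' : ℕ} {a a' : OSym M} (h : resW e M n j a = resW e M n j' a') :
    j = j' ∧ a = a' := by
  simp only [resW] at h
  have h' : j * A₁ M + (eA M a : ℕ) = j' * A₁ M + (eA M a' : ℕ) := by omega
  have := mix_inj h' (eA M a).isLt (eA M a').isLt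
  exact ⟨this.1, (eA M).injective (Fin.ext this.2)⟩

/-- Result wires lie after the tableau. [folklore] -/
theorem NN_le_resW (n j : ℕ) (a : OSym M) : NN e M n ≤ resW e M n j a := Nat.le_add_right _ _

/-- Result wires lie inside the block. [folklore] -/
theorem resW_lt_width {n j : ℕ} (hj : j < JJ e M n) (a : OSym M) : resW e M n j a < width e M n := by
  simp only [resW, width, copyN]
  have h1 : (eA M a : ℕ) < A₁ M := (eA M a).isLt
  have h2 : j * A₁ M + A₁ M ≤ JJ e M n * A₁ M := by
    rw [← Nat.succ_mul]; exact Nat.mul_le_mul_right _ (Nat.succ_le_of_lt hj)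
  omega

/-- Members of the read-out pairs. [folklore] -/
theorem mem_outPairs {n : ℕ} {p : ℕ × ℕ} :
    p ∈ outPairs e M n ↔ ∃ j < JJ e M n, ∃ a : OSym M,
      p = (cellW M.tm e n (Tn e n) j ⟨M.tm.k₁, a⟩, resW e M n j a) := by
  simp only [outPairs, List.mem_flatMap, List.mem_range, List.mem_map]
  constructor
  · rintro ⟨j, hj, a, -, rfl⟩; exact ⟨j, hj, a, rfl⟩
  · rintro ⟨j, hj, a, rfl⟩; exact ⟨j, hj, a, mem_aList a, rfl⟩

/-- Sources of the read-out are tableau wires. [folklore] -/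
theorem cellW_T_lt_NN {n j : ℕ} (hj : j < JJ e M n) (a : OSym M) :
    cellW M.tm e n (Tn e n) j ⟨M.tm.k₁, a⟩ < NN e M n := by
  rw [NN_eq]
  exact ((cellW_lt_RB hj _).trans_le (RB_le_ansW le_rfl)).trans (Nat.lt_succ_self _)

/-- The targets of the read-out are pairwise distinct. [folklore] -/
theorem nodup_outPairs_snd (n : ℕ) : ((outPairs e M n).map Prod.snd).Nodup := by
  rw [outPairs, List.map_flatMap]
  refine List.nodup_flatMap.2 ⟨fun j _ => ?_, ?_⟩
  · rw [List.map_map]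
    exact nodup_aList.map fun a a' h => (resW_inj h).2
  · refine List.Nodup.pairwise_of_forall_ne List.nodup_range fun j _ j' _ hjj' => ?_
    simp only [List.map_map, Function.onFun]
    intro x hx hx'
    simp only [List.mem_map, Function.comp_apply] at hx hx'
    obtain ⟨a, -, rfl⟩ := hx
    obtain ⟨a', -, h⟩ := hx'
    exact hjj' (resW_inj h).1.symm

/-- Every operation of the compute half is well formed. [folklore] -/
theorem comp_wf {n : ℕ} : ∀ op ∈ comp e M n, op.WF := by
  intro op hop
  simp only [comp, List.mem_append, List.mem_flatMap, List.mem_range] at hop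
  rcases hop with h | ⟨t, -, h⟩
  · exact inputOps_wf op h
  · exact stepOps_wf op h

/-- The compute half uses tableau wires only. [folklore] -/
theorem comp_lt {n : ℕ} : ∀ op ∈ comp e M n, ∀ i ∈ wiresOf op, i < NN e M n := by
  intro op hop
  rw [NN_eq]
  simp only [comp, List.mem_append, List.mem_flatMap, List.mem_range] at hop
  rcases hop with h | ⟨t, ht, h⟩
  · exact inputOps_lt op h
  · exact stepOps_lt ht op h

/-- Every operation of the compute half writes behind the input wires. [folklore] -/
theorem le_target_of_mem_comp {n : ℕ} {op : ClOp ℕ} (hop : op ∈ comp e M n) : n ≤ op.target := by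
  simp only [comp, List.mem_append, List.mem_flatMap, List.mem_range] at hop
  rcases hop with h | ⟨t, -, h⟩
  · exact (inputOps_zones h).1
  · simp only [stepOps, List.mem_append, List.mem_flatMap] at h
    rcases h with ⟨v, -, h⟩ | h
    · have ha := target_mem_of_mem_clChain h
      obtain ⟨m, -, hm⟩ := mem_ancs_iff.1 ha
      rw [hm]
      exact ((LB_zero M.tm e n).symm.trans_le (LB_mono n (Nat.zero_le t))).trans
        ((Nat.le_add_right _ _).trans (RB_le_ancW n t v m))
    · exact ((LB_zero M.tm e n).symm.trans_le (LB_mono n (Nat.zero_le (t + 1)))).trans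
        (restOps_zones h).1

/-- The `NOT` gates of the suffix are well formed. [folklore] -/
theorem notsV_wf {n₀ : ℕ} {v : List Bool} : ∀ op ∈ notsV n₀ v, op.WF := by
  intro op hop
  simp only [notsV, List.mem_map] at hop
  obtain ⟨i, -, rfl⟩ := hop
  trivial

/-- The `NOT` gates of the suffix act on the wires `n₀ ≤ · < n₀ + |v|`. [folklore] -/
theorem notsV_lt {n₀ : ℕ} {v : List Bool} : ∀ op ∈ notsV n₀ v, ∀ i ∈ wiresOf op, i < n₀ + v.length := by
  intro op hop i hi
  simp only [notsV, List.mem_map, List.mem_filter, List.mem_range] at hop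
  obtain ⟨i', ⟨hi', -⟩, rfl⟩ := hop
  simp only [mem_wiresOf, ClOp.target, ClOp.controls, List.not_mem_nil, or_false] at hi
  omega

/-- The tableau lies inside the block. [folklore] -/
theorem NN_le_width (n : ℕ) : NN e M n ≤ width e M n := Nat.le_add_right _ _

/-- The input wires lie before the tableau. [folklore] -/
theorem le_NN (n : ℕ) : n ≤ NN e M n := Nat.le_add_right _ _

/-- The read-out is well formed. [folklore] -/
theorem outOps_wf {n : ℕ} : ∀ op ∈ outOps e M n, op.WF :=
  copyOps_wf fun p hp => by
    obtain ⟨j, hj, a, rfl⟩ := mem_outPairs.1 hp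
    exact ((cellW_T_lt_NN hj a).trans_le (NN_le_resW n j a)).ne

/-- The read-out uses wires of the block. [folklore] -/
theorem outOps_lt {n : ℕ} : ∀ op ∈ outOps e M n, ∀ i ∈ wiresOf op, i < width e M n := by
  intro op hop i hi
  obtain ⟨p, hp, rfl⟩ := mem_copyOps.1 hop
  obtain ⟨j, hj, a, rfl⟩ := mem_outPairs.1 hp
  simp only [mem_wiresOf, ClOp.target, ClOp.controls, List.mem_singleton] at hi
  rcases hi with rfl | rfl
  · exact resW_lt_width hj a
  · exact (cellW_T_lt_NN hj a).trans_le (NN_le_width n)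

/-- **Every operation of the clean block is well formed.** [folklore] -/
theorem cleanOps_wf {n₀ : ℕ} {v : List Bool} : ∀ op ∈ cleanOps e M n₀ v, op.WF := by
  intro op hop
  simp only [cleanOps, List.mem_append] at hop
  rcases hop with h | h | h | h | h
  · exact notsV_wf op h
  · exact comp_wf op h
  · exact outOps_wf op h
  · exact wf_reverse comp_wf op h
  · exact notsV_wf op h

/-- **The clean block uses the wires `< width`.** [folklore] -/
theorem cleanOps_lt {n₀ : ℕ} {v : List Bool} :
    ∀ op ∈ cleanOps e M n₀ v, ∀ i ∈ wiresOf op, i < width e M (n₀ + v.length) := by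
  intro op hop
  simp only [cleanOps, List.mem_append] at hop
  rcases hop with h | h | h | h | h
  · exact fun i hi => (notsV_lt op h i hi).trans_le ((le_NN _).trans (NN_le_width _))
  · exact fun i hi => (comp_lt op h i hi).trans_le (NN_le_width _)
  · exact outOps_lt op h
  · exact fun i hi => (comp_lt op (List.mem_reverse.1 h) i hi).trans_le (NN_le_width _)
  · exact fun i hi => (notsV_lt op h i hi).trans_le ((le_NN _).trans (NN_le_width _))

end Layout

/-! ### Semantics of the clean block -/

section Semantics

variable {e : ℕ} {M : TM2ComputableAux Bool Bool}

/-- The string assignment: the word `u` on the first `|u|` wires, `0` elsewhere. [folklore] -/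
def strW (u : List Bool) : ℕ → Bool := fun i => u.getD i false

/-- The input of the tableau, as a function on `Fin n`. [folklore] -/
def xOf (u : List Bool) (n : ℕ) : Fin n → Bool := fun i => u.getD i false

/-- `strW u` is the initial assignment `W₀` of the tableau on input `xOf u n`, `n = |u|`.
[folklore] -/
theorem W₀_xOf {u : List Bool} {n : ℕ} (hn : u.length = n) : W₀ n (xOf u n) = strW u := by
  funext i
  simp only [W₀, xOf, strW]
  split_ifs with h
  · rfl
  · rw [List.getD_eq_default]; omega

/-- `xOf u n` lists `u`. [folklore] -/
theorem ofFn_xOf {u : List Bool} {n : ℕ} (hn : u.length = n) : List.ofFn (xOf u n) = u := by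
  subst hn
  apply List.ext_getElem (by simp)
  intro i h₁ h₂
  simp only [List.getElem_ofFn, xOf]
  rw [List.getD_eq_getElem?_getD, List.getElem?_eq_getElem h₂, Option.getD_some]

open Classical in
/-- The read-out bit of cell `j` and code `a`: cell `j` of the output stack of the halting
configuration with output word `l'` holds code `a`. [folklore] -/
noncomputable def outBit (M : TM2ComputableAux Bool Bool) (l' : List Bool) (j : ℕ) (a : OSym M) : Bool :=
  decide (cellVal (haltList M.tm (l'.map M.outputAlphabet.symm)) j M.tm.k₁ = a)

/-- **The contents of the work wires after the block** (as a function of the output word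
`l'`): the result wire `resW n j a` holds `outBit l' j a`, every other work wire `0`.
[folklore] -/
noncomputable def readOut (e : ℕ) (M : TM2ComputableAux Bool Bool) (n : ℕ) (l' : List Bool) (i : ℕ) : Bool :=
  if NN e M n ≤ i ∧ i < NN e M n + copyN e M n then
    outBit M l' ((i - NN e M n) / A₁ M)
      ((eA M).symm ⟨(i - NN e M n) % A₁ M, Nat.mod_lt _ (one_le_A₁ (M := M))⟩)
  else false

/-- `readOut` on a result wire. [folklore] -/
theorem readOut_resW {n j : ℕ} (hj : j < JJ e M n) (a : OSym M) (l' : List Bool) :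
    readOut e M n l' (resW e M n j a) = outBit M l' j a := by
  have hlt := resW_lt_width (e := e) hj a
  rw [width] at hlt
  rw [readOut, if_pos ⟨NN_le_resW n j a, hlt⟩]
  have hA := one_le_A₁ (M := M)
  have hm : resW e M n j a - NN e M n = j * A₁ M + (eA M a : ℕ) := by simp [resW]
  have hr : (eA M a : ℕ) < A₁ M := (eA M a).isLt
  have hdiv : (resW e M n j a - NN e M n) / A₁ M = j := by
    rw [hm, Nat.add_comm, Nat.add_mul_div_right _ _ (by omega), Nat.div_eq_of_lt hr, Nat.zero_add]
  have hmod : (resW e M n j a - NN e M n) % A₁ M = (eA M a : ℕ) := by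
    rw [hm, Nat.add_comm, Nat.add_mul_mod_self_right, Nat.mod_eq_of_lt hr]
  congr 1
  rw [Equiv.symm_apply_eq]
  exact Fin.ext hmod

/-- A work wire in the result zone is a result wire. [folklore] -/
theorem exists_resW_eq {n i : ℕ} (h1 : NN e M n ≤ i) (h2 : i < NN e M n + copyN e M n) :
    ∃ j < JJ e M n, ∃ a : OSym M, resW e M n j a = i := by
  have hA := one_le_A₁ (M := M)
  refine ⟨(i - NN e M n) / A₁ M, ?_, (eA M).symm ⟨(i - NN e M n) % A₁ M, Nat.mod_lt _ hA⟩, ?_⟩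
  · rw [copyN] at h2
    exact Nat.div_lt_of_lt_mul (by rw [Nat.mul_comm]; omega)
  · simp only [resW, Equiv.apply_symm_apply]
    have := Nat.div_add_mod (i - NN e M n) (A₁ M)
    rw [Nat.mul_comm] at this
    omega

/-- The `NOT` gates of the suffix, as negations of a list of wires. [folklore] -/
theorem notsV_eq (n₀ : ℕ) (v : List Bool) :
    notsV n₀ v = (((List.range v.length).filter fun i => v.getD i false).map (n₀ + ·)).map ClOp.not := by
  simp [notsV, List.map_map, Function.comp_def]

/-- **The suffix gadget** flips exactly the wires `n₀ + i` with `v i = 1`. [folklore] -/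
theorem clEval_notsV_apply (n₀ : ℕ) (v : List Bool) (w : ℕ → Bool) (i : ℕ) :
    clEval (notsV n₀ v) w i =
      (w i ^^ (decide (n₀ ≤ i ∧ i < n₀ + v.length) && v.getD (i - n₀) false)) := by
  rw [notsV_eq]
  set L := ((List.range v.length).filter fun i => v.getD i false).map (n₀ + ·) with hL
  have hmem : i ∈ L ↔ n₀ ≤ i ∧ i < n₀ + v.length ∧ v.getD (i - n₀) false = true := by
    simp only [hL, List.mem_map, List.mem_filter, List.mem_range]
    constructor
    · rintro ⟨i', ⟨hi', hv⟩, rfl⟩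
      exact ⟨Nat.le_add_right _ _, by omega, by simpa using hv⟩
    · rintro ⟨h1, h2, hv⟩
      exact ⟨i - n₀, ⟨by omega, hv⟩, by omega⟩
  by_cases hi : i ∈ L
  · have hnd : L.Nodup :=
      ((List.nodup_range.filter _).map fun a b h => Nat.add_left_cancel h)
    rw [clEval_map_not_of_mem L hnd w hi]
    obtain ⟨h1, h2, hv⟩ := hmem.1 hi
    rw [hv]
    simp [h1, h2]
  · rw [clEval_map_not_of_not_mem L w hi]
    have : ¬ (n₀ ≤ i ∧ i < n₀ + v.length ∧ v.getD (i - n₀) false = true) := fun h => hi (hmem.2 h)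
    by_cases h1 : n₀ ≤ i ∧ i < n₀ + v.length
    · have hv : v.getD (i - n₀) false = false := by
        cases hgv : v.getD (i - n₀) false
        · rfl
        · exact absurd ⟨h1.1, h1.2, hgv⟩ this
      rw [hv]
      simp
    · simp [h1]

/-- The suffix gadget writes `v` behind `d`. [folklore] -/
theorem clEval_notsV_strW (d v : List Bool) :
    clEval (notsV d.length v) (strW d) = strW (d ++ v) := by
  funext i
  rw [clEval_notsV_apply]
  simp only [strW]
  by_cases h1 : i < d.length
  · rw [List.getD_append _ _ _ _ h1]
    simp [not_le.2 h1]
  · rw [List.getD_eq_default _ _ (not_lt.1 h1), List.getD_append_right _ _ _ _ (not_lt.1 h1)]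
    by_cases h2 : i < d.length + v.length
    · simp [not_lt.1 h1, h2]
    · rw [List.getD_eq_default _ _ (by omega)]
      simp [h2]

/-- Read-out pairs: no target is a source. [folklore] -/
theorem outPairs_target_ne_source {n : ℕ} :
    ∀ p ∈ outPairs e M n, ∀ q ∈ outPairs e M n, q.2 ≠ p.1 := by
  intro p hp q hq
  obtain ⟨j, hj, a, rfl⟩ := mem_outPairs.1 hp
  obtain ⟨j', hj', a', rfl⟩ := mem_outPairs.1 hq
  exact ((cellW_T_lt_NN hj a).trans_le (NN_le_resW n j' a')).ne'

/-- The targets of the read-out lie in `[NN, width)`. [folklore] -/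
theorem outPairs_target_bounds {n : ℕ} {p : ℕ × ℕ} (hp : p ∈ outPairs e M n) :
    NN e M n ≤ p.2 ∧ p.2 < width e M n := by
  obtain ⟨j, hj, a, rfl⟩ := mem_outPairs.1 hp
  exact ⟨NN_le_resW n j a, resW_lt_width hj a⟩

/-- **Semantics of the clean block** (Bennett's compute–copy–uncompute). If `M`, started on
the word `d ++ v`, halts with output word `l'` within `T(n) = (n+2)^e` steps (`n = |d| + |v|`),
then the block maps the assignment `d 0 0 …` (data `d` on the first `|d|` wires, all work wires
`0`) to: data unchanged, result wires holding `readOut l'`, all other work wires `0` again.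
[Bennett 1973, §2; Shor 1997, §3, p. 8; Kitaev 1995, §2.2, Lemma 1]
[cite: Shor1997, §3 p.8 (compute F(x) keeping x, copy, undo)] -/
theorem clEval_cleanOps (d v l' : List Bool)
    (hM : M.OutputsWithin (d ++ v) l' (Tn e (d.length + v.length))) :
    clEval (cleanOps e M d.length v) (strW d) =
      fun i => if i < d.length then d.getD i false else readOut e M (d.length + v.length) l' i := by
  set n := d.length + v.length with hn_def
  set u := d ++ v with hu
  have hn : u.length = n := by simp [hu, hn_def]
  set x : Fin n → Bool := xOf u n with hx
  have hM' : M.OutputsWithin (List.ofFn x) l' (Tn e n) := by rwa [hx, ofFn_xOf hn]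
  -- the run of the tableau
  have hsteps : clEval (comp e M n) (strW u) = wAt (e := e) (M := M) n x (Tn e n) := by
    rw [← W₀_xOf hn]; exact clEval_steps n x (Tn e n)
  have hinv : Inv e n (Tn e n) (cfgAt M n x (Tn e n)) (wAt (e := e) (M := M) n x (Tn e n)) :=
    inv_wAt n x _ le_rfl
  have hcfg : cfgAt M n x (Tn e n) = haltList M.tm (l'.map M.outputAlphabet.symm) :=
    TM2Sim.iterate_stepTotal_of_outputsWithin M hM'
  set w2 := wAt (e := e) (M := M) n x (Tn e n) with hw2
  have h2a : ∀ i, i < n → w2 i = strW u i := by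
    intro i hi
    rw [← hsteps]
    exact clEval_apply_of_forall_target_ne _ _ fun op hop heq =>
      absurd (le_target_of_mem_comp hop) (by rw [heq]; exact not_le.2 hi)
  have h2c : ∀ i, NN e M n ≤ i → w2 i = false := fun i hi =>
    hinv.fresh i ((RB_le_ansW le_rfl).trans (Nat.le_of_succ_le (by rwa [NN_eq] at hi)))
  have h2b : ∀ j < JJ e M n, ∀ a : OSym M,
      w2 (cellW M.tm e n (Tn e n) j ⟨M.tm.k₁, a⟩) = outBit M l' j a := by
    intro j hj a
    have := hinv.cell j hj ⟨M.tm.k₁, a⟩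
    rw [hcfg] at this
    rw [this, outBit]
  -- the read-out
  set w3 := clEval (outOps e M n) w2 with hw3
  have h3a : ∀ j < JJ e M n, ∀ a : OSym M, w3 (resW e M n j a) = outBit M l' j a := by
    intro j hj a
    have hp : (cellW M.tm e n (Tn e n) j ⟨M.tm.k₁, a⟩, resW e M n j a) ∈ outPairs e M n :=
      mem_outPairs.2 ⟨j, hj, a, rfl⟩
    have := clEval_copyOps_target (outPairs e M n) (nodup_outPairs_snd n)
      outPairs_target_ne_source w2 hp
    simp only at this
    rw [hw3, outOps, this, h2c _ (NN_le_resW n j a), Bool.false_xor, h2b j hj a]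
  have h3b : ∀ i, (∀ p ∈ outPairs e M n, p.2 ≠ i) → w3 i = w2 i := fun i hi =>
    clEval_copyOps_of_ne _ _ hi
  have h3lo : ∀ i, i < NN e M n → w3 i = w2 i := fun i hi =>
    h3b i fun p hp heq => absurd (outPairs_target_bounds hp).1 (by rw [heq]; exact not_le.2 hi)
  -- the uncomputation
  have hagree : ∀ i, i < NN e M n →
      clEval (comp e M n).reverse w3 i = clEval (comp e M n).reverse w2 i :=
    clEval_agree (fun i => i < NN e M n) _
      (fun op hop i hi => comp_lt op (List.mem_reverse.1 hop) i hi) (fun i hi => h3lo i hi)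
  have h4 : clEval (comp e M n).reverse w3 = fun i => if NN e M n ≤ i then w3 i else strW u i := by
    funext i
    split_ifs with h
    · refine clEval_apply_of_forall_target_ne _ _ fun op hop heq => ?_
      have := comp_lt op (List.mem_reverse.1 hop) op.target (by simp)
      rw [heq] at this
      exact absurd this (not_lt.2 h)
    · rw [hagree i (not_le.1 h)]
      show clEval (comp e M n).reverse w2 i = strW u i
      rw [← hsteps, clEval_reverse_clEval _ comp_wf]
  -- assembling
  rw [cleanOps, clEval_append, clEval_notsV_strW, clEval_append, ← hu, hsteps, clEval_append,
    ← hw3, clEval_append, h4]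
  funext i
  rw [clEval_notsV_apply]
  by_cases hi : i < d.length
  · -- data wires
    have h1 : ¬ NN e M n ≤ i := not_le.2 (lt_of_lt_of_le hi ((Nat.le_add_right _ _).trans (le_NN n)))
    rw [if_neg h1, if_pos hi]
    simp only [not_le.2 hi, false_and, decide_false, Bool.false_and, Bool.xor_false, strW, hu]
    exact List.getD_append _ _ _ _ hi
  · rw [if_neg hi]
    by_cases hiv : i < d.length + v.length
    · -- the suffix wires are cleared
      have h1 : ¬ NN e M n ≤ i := not_le.2 (lt_of_lt_of_le hiv (le_NN n))
      rw [if_neg h1]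
      simp only [not_lt.1 hi, hiv, and_self, decide_true, Bool.true_and, strW, hu]
      rw [List.getD_append_right _ _ _ _ (not_lt.1 hi), Bool.xor_self, readOut, if_neg]
      exact fun h => h1 h.1
    · simp only [hiv, and_false, decide_false, Bool.false_and, Bool.xor_false]
      by_cases h1 : NN e M n ≤ i
      · rw [if_pos h1]
        by_cases h2 : i < NN e M n + copyN e M n
        · obtain ⟨j, hj, a, rfl⟩ := exists_resW_eq h1 h2
          rw [h3a j hj a, readOut_resW hj]
        · rw [readOut, if_neg (fun h => h2 h.2), h3b i, h2c i h1]
          intro p hp heq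
          have := (outPairs_target_bounds hp).2
          rw [heq, width] at this
          exact h2 this
      · rw [if_neg h1, readOut, if_neg (fun h => h1 h.1)]
        simp only [strW, hu]
        rw [List.getD_eq_default]
        simp only [List.length_append]
        omega

/-- The data wires are unchanged by the block. [folklore] -/
theorem clEval_cleanOps_of_lt (d v l' : List Bool)
    (hM : M.OutputsWithin (d ++ v) l' (Tn e (d.length + v.length))) {i : ℕ} (hi : i < d.length) :
    clEval (cleanOps e M d.length v) (strW d) i = d.getD i false := by
  rw [clEval_cleanOps d v l' hM]
  simp [hi]

/-- The work wires hold the read-out after the block. [folklore] -/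
theorem clEval_cleanOps_of_le (d v l' : List Bool)
    (hM : M.OutputsWithin (d ++ v) l' (Tn e (d.length + v.length))) {i : ℕ} (hi : d.length ≤ i) :
    clEval (cleanOps e M d.length v) (strW d) i = readOut e M (d.length + v.length) l' i := by
  rw [clEval_cleanOps d v l' hM]
  simp [not_lt.2 hi]

end Semantics

/-! ### The read-out determines the output word -/

section ReadOut

variable {e : ℕ} {M : TM2ComputableAux Bool Bool}

/-- Cells of the output stack of a halting configuration, inside the output word. [folklore] -/
theorem cellVal_haltList_of_lt {l' : List Bool} (hgood : TM2Sim.Good M.tm (haltList M.tm (l'.map M.outputAlphabet.symm)))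
    {j : ℕ} (hj : j < l'.length) :
    ∃ h : TM2Sim.IsSym M.tm M.tm.k₁ (M.outputAlphabet.symm (l'[j])),
      cellVal (haltList M.tm (l'.map M.outputAlphabet.symm)) j M.tm.k₁ = some ⟨_, h⟩ := by
  have hsym : TM2Sim.IsSym M.tm M.tm.k₁ (M.outputAlphabet.symm (l'[j])) := by
    refine hgood M.tm.k₁ _ ?_
    rw [TM2Comp.haltList_eq]
    simp only [Function.update_self, List.mem_map]
    exact ⟨l'[j], List.getElem_mem hj, rfl⟩
  refine ⟨hsym, ?_⟩
  rw [TM2Comp.haltList_eq]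
  simp only [cellVal, Function.update_self, List.getElem?_map, List.getElem?_eq_getElem hj,
    Option.map_some, Option.bind_some]
  exact toSym_of_isSym _ hsym

/-- Cells of the output stack of a halting configuration, beyond the output word. [folklore] -/
theorem cellVal_haltList_of_le {l' : List Bool} {j : ℕ} (hj : l'.length ≤ j) :
    cellVal (haltList M.tm (l'.map M.outputAlphabet.symm)) j M.tm.k₁ = none := by
  rw [TM2Comp.haltList_eq]
  simp only [cellVal, Function.update_self]
  rw [List.getElem?_eq_none (by simpa using hj)]
  rfl

/-- Output words fit into the represented cells, and their symbols are reachable. [folklore] -/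
theorem length_lt_JJ_of_outputsWithin {n : ℕ} {u l' : List Bool} (hu : u.length = n)
    (hM : M.OutputsWithin u l' (Tn e n)) :
    l'.length < JJ e M n ∧ TM2Sim.Good M.tm (haltList M.tm (l'.map M.outputAlphabet.symm)) := by
  have hM' : M.OutputsWithin (List.ofFn (xOf u n)) l' (Tn e n) := by rwa [ofFn_xOf hu]
  have hcfg : cfgAt M n (xOf u n) (Tn e n) = haltList M.tm (l'.map M.outputAlphabet.symm) :=
    TM2Sim.iterate_stepTotal_of_outputsWithin M hM'
  constructor
  · have h := length_cfgAt_le_Sn (e := e) (M := M) n (xOf u n) (t := Tn e n) le_rfl M.tm.k₁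
    rw [hcfg, TM2Comp.haltList_eq] at h
    simp only [Function.update_self, List.length_map] at h
    have := one_le_dd M.tm
    rw [JJ]; omega
  · have h := good_cfgAt (M := M) n (xOf u n) (Tn e n)
    rwa [hcfg] at h

/-- **The read-out is injective on output words**: two runs (on inputs of the same length `n`,
both halting within `T(n)`) with the same read-out have the same output word. [folklore] -/
theorem eq_of_readOut_eq {n : ℕ} {u₁ u₂ l₁ l₂ : List Bool} (hu₁ : u₁.length = n) (hu₂ : u₂.length = n)
    (h₁ : M.OutputsWithin u₁ l₁ (Tn e n)) (h₂ : M.OutputsWithin u₂ l₂ (Tn e n))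
    (h : readOut e M n l₁ = readOut e M n l₂) : l₁ = l₂ := by
  obtain ⟨hL₁, hg₁⟩ := length_lt_JJ_of_outputsWithin hu₁ h₁
  obtain ⟨hL₂, hg₂⟩ := length_lt_JJ_of_outputsWithin hu₂ h₂
  have hbit : ∀ j < JJ e M n, ∀ a : OSym M, outBit M l₁ j a = outBit M l₂ j a := by
    intro j hj a
    have := congrFun h (resW e M n j a)
    rwa [readOut_resW hj, readOut_resW hj] at this
  have hcell : ∀ j < JJ e M n, cellVal (haltList M.tm (l₁.map M.outputAlphabet.symm)) j M.tm.k₁ =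
      cellVal (haltList M.tm (l₂.map M.outputAlphabet.symm)) j M.tm.k₁ := by
    intro j hj
    have := hbit j hj (cellVal (haltList M.tm (l₁.map M.outputAlphabet.symm)) j M.tm.k₁)
    simp only [outBit, decide_true, true_eq_decide_iff] at this
    exact this.symm
  -- equal lengths
  have hlen : l₁.length = l₂.length := by
    by_contra hne
    rcases Nat.lt_or_gt_of_ne hne with hlt | hlt
    · obtain ⟨_, h2⟩ := cellVal_haltList_of_lt hg₂ hlt
      have h1 := cellVal_haltList_of_le (M := M) (l' := l₁) (le_refl l₁.length)
      rw [hcell _ hL₁, h2] at h1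
      exact Option.some_ne_none _ h1
    · obtain ⟨_, h1⟩ := cellVal_haltList_of_lt hg₁ hlt
      have h2 := cellVal_haltList_of_le (M := M) (l' := l₂) (le_refl l₂.length)
      rw [← hcell _ hL₂, h1] at h2
      exact Option.some_ne_none _ h2
  -- equal entries
  apply List.ext_getElem hlen
  intro j hj₁ hj₂
  obtain ⟨_, e1⟩ := cellVal_haltList_of_lt hg₁ hj₁
  obtain ⟨_, e2⟩ := cellVal_haltList_of_lt hg₂ hj₂
  have := hcell j (hj₁.trans hL₁)
  rw [e1, e2, Option.some.injEq] at this
  have := congrArg Subtype.val this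
  exact M.outputAlphabet.symm.injective this

end ReadOut

/-! ### From `FP` to a time bound of the form `(n+2)^e` -/

section Bridge

/-- A polynomial is dominated by a power of `n + 2`. [folklore] -/
theorem _root_.Polynomial.exists_eval_le_pow_add_two (p : Polynomial ℕ) :
    ∃ e : ℕ, ∀ n : ℕ, p.eval n ≤ (n + 2) ^ e := by
  induction p using Polynomial.induction_on' with
  | add p q hp hq =>
    obtain ⟨a, ha⟩ := hp
    obtain ⟨b, hb⟩ := hq
    refine ⟨max a b + 1, fun n => ?_⟩
    rw [Polynomial.eval_add, pow_succ]
    have h1 : (n + 2) ^ a ≤ (n + 2) ^ max a b := Nat.pow_le_pow_right (by omega) (le_max_left _ _)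
    have h2 : (n + 2) ^ b ≤ (n + 2) ^ max a b := Nat.pow_le_pow_right (by omega) (le_max_right _ _)
    have := ha n; have := hb n
    nlinarith
  | monomial k c =>
    refine ⟨k + c, fun n => ?_⟩
    rw [Polynomial.eval_monomial, pow_add]
    have h1 : n ^ k ≤ (n + 2) ^ k := Nat.pow_le_pow_left (by omega) k
    have h2 : c ≤ (n + 2) ^ c := by
      calc c ≤ 2 ^ c := Nat.lt_two_pow_self.le
        _ ≤ (n + 2) ^ c := Nat.pow_le_pow_left (by omega) c
    calc c * n ^ k ≤ (n + 2) ^ c * (n + 2) ^ k := Nat.mul_le_mul h2 h1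
      _ = (n + 2) ^ k * (n + 2) ^ c := Nat.mul_comm _ _

/-- **Machines for `FP` functions with a power time bound.** A polynomial-time string function is
computed by a bundled `TM2` machine halting within `(n+2)^e` steps on inputs of length `n`.
[Arora–Barak 2009, §1.3] [cite: AroraBarak2009, §1.3] -/
theorem exists_outputsWithin_pow_of_mem_FP {f : List Bool → List Bool} (hf : f ∈ FP) :
    ∃ (e : ℕ) (M : TM2ComputableAux Bool Bool), ∀ u : List Bool, M.OutputsWithin u (f u) (Tn e u.length) := by
  obtain ⟨p, M, hM⟩ := hf
  obtain ⟨e, he⟩ := p.exists_eval_le_pow_add_two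
  exact ⟨e, M, fun u => (hM u).mono (he u.length)⟩

end Bridge

end RevClean

end Literature.Computability.QuantumComplexity
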